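import Mathlib.RingTheory.RegularLocalRing.Defs
import Mathlib.RingTheory.Localization.AtPrime.Basic
import Mathlib.RingTheory.IntegralClosure.IntegrallyClosed
import Mathlib.RingTheory.UniqueFactorizationDomain.Defs
import HarnessLib

/-!
# Regular local rings: the classical structure theorems (Matsumura, Ch. 5 and Ch. 7)

Topic: `Literature/AlgebraicGeometry/Resolution`. Named facts filed by a grounder for route
`ResolutionOfSingularities/Valuative` (items `stmt-ResolutionOfSingularities-0739`
`LurelOfResolution`, `-0641` `LuAlphaPTorsor`, `-0643` `TorsorToLurelFfinite`, `-0642`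
`PatchingRel`), whose paper proofs use, about the regular local ring at the centre of a
valuation, that it is a DOMAIN (so it embeds in the function field), NORMAL (so it absorbs
`p`-th roots lying in the fraction field) and stays regular under LOCALISATION (generisation of
the centre). Mathlib (this tree) has `IsRegularLocalRing` (`RingTheory/RegularLocalRing/Defs`)
with `of_ringEquiv`, the DVR instance and polynomial stability, but none of the four theorems
below; they are vendored here as `Prop`-valued named facts, to be taken as hypotheses
`(h : Matsumura1987_14_3)` etc. until Mathlib proves them.

## Content

* `Matsumura1987_14_3` — a regular local ring is an integral domain.
* `Matsumura1987_19_3` — a localisation of a regular local ring at a prime is regular (Serre).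
* `Matsumura1987_19_4` — a regular local ring is normal (integrally closed in its fraction
  field).
* `Matsumura1987_20_3` — a regular local ring is a UFD (Auslander–Buchsbaum 1959).

## Source

* H. Matsumura, *Commutative Ring Theory*, Cambridge Stud. Adv. Math. 8, CUP 1986/87 (transl.
  M. Reid): Thm. 14.3 (PDF p. 122: "A regular local ring is an integral domain."), Thm. 19.3 (PDF p. 173: localisation of a regular ring is regular), Thm. 19.4 (PDF
  p. 173: "A regular ring is normal."; proof p. 174: "it is enough to show that a regular local
  ring is normal"), Thm. 20.3 (PDF p. 179: "(Auslander and Buchsbaum) A regular local ring is a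
  UFD.").

## Rendering notes

* Mathlib's `IsRegularLocalRing R` = Noetherian local with `spanFinrank 𝔪 ≤ dim R`, i.e.
  `emb dim = dim` (Matsumura §14, p. 121), so the hypotheses match verbatim.
* "normal" for a local domain = integrally closed in its field of fractions = Mathlib
  `IsIntegrallyClosed R` (Matsumura §9, p. 64: a normal ring is one all of whose localisations
  are integrally closed domains; for a local domain this is `IsIntegrallyClosed`). Thm. 19.4 is
  stated for a regular local ring together with the domain conclusion of Thm. 14.3, bundled as
  `IsDomain R ∧ IsIntegrallyClosed R` so that users need only one hypothesis.
* Thm. 20.3 needs a `CancelCommMonoidWithZero` structure to state `UniqueFactorizationMonoid`;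
  it is stated for rings that already carry an `IsDomain` instance (supplied by Thm. 14.3).
* Thm. 19.3 in the book is "`A` regular local, `P` prime ⇒ `A_P` regular local"; stated with
  Mathlib's `Localization.AtPrime`.
-/

noncomputable section

namespace Literature.AlgebraicGeometry.Resolution

universe u

/-- NAMED FACT — **Matsumura, Thm. 14.3**: "A regular local ring is an integral domain."
Users take `(h : Matsumura1987_14_3)`. Grounds the Lean glue of
`Summit.ResolutionOfSingularities.ResolutionOfSingularities.Theses.Valuative.LurelOfResolution`
(the regular stalk `𝒪_{X',x'}` at the centre embeds in the function field).
[cite: Matsumura1987, Thm. 14.3] -/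
def Matsumura1987_14_3 : Prop :=
  ∀ (R : Type u) [CommRing R], IsRegularLocalRing R → IsDomain R

/-- NAMED FACT — **Matsumura, Thm. 19.3** (Serre): if `A` is a regular local ring and `P` a
prime ideal of `A` then the localisation `A_P` is again a regular local ring. Users take
`(h : Matsumura1987_19_3)`. [cite: Matsumura1987, Thm. 19.3] -/
def Matsumura1987_19_3 : Prop :=
  ∀ (R : Type u) [CommRing R], IsRegularLocalRing R →
    ∀ (P : Ideal R) [P.IsPrime], IsRegularLocalRing (Localization.AtPrime P)

/-- NAMED FACT — **Matsumura, Thm. 19.4** ("A regular ring is normal"; proof: "it is enough to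
show that a regular local ring is normal"), combined with Thm. 14.3: a regular local ring is an
integrally closed domain. Users take `(h : Matsumura1987_19_4)`. Grounds the "absorb `p`-th
roots lying in `Frac A₀` by normality of the regular centre" step of
`Summit.ResolutionOfSingularities.ResolutionOfSingularities.Theses.Valuative.LuAlphaPTorsor`
and `.TorsorToLurelFfinite`. [cite: Matsumura1987, Thm. 19.4] -/
def Matsumura1987_19_4 : Prop :=
  ∀ (R : Type u) [CommRing R], IsRegularLocalRing R → IsDomain R ∧ IsIntegrallyClosed R

/-- NAMED FACT — **Matsumura, Thm. 20.3** (Auslander and Buchsbaum): "A regular local ring is a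
UFD." Stated for a ring already known to be a domain (Thm. 14.3), as Mathlib's
`UniqueFactorizationMonoid` needs the cancellative structure. Users take
`(h : Matsumura1987_20_3)`. [cite: Matsumura1987, Thm. 20.3] -/
def Matsumura1987_20_3 : Prop :=
  ∀ (R : Type u) [CommRing R] [IsDomain R], IsRegularLocalRing R → UniqueFactorizationMonoid R

/-! ## API -/

/-- Thm. 19.4 as vendored contains Thm. 14.3. [folklore] -/
theorem Matsumura1987_19_4.isDomain (h : Matsumura1987_19_4.{u}) : Matsumura1987_14_3.{u} :=
  fun R _ hR => (h R hR).1

/-- Under Thm. 14.3, a regular local ring has no zero divisors (convenience for users who need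
`NoZeroDivisors` rather than the `IsDomain` mixin). [folklore] -/
theorem Matsumura1987_14_3.noZeroDivisors (h : Matsumura1987_14_3.{u}) (R : Type u) [CommRing R]
    [IsRegularLocalRing R] : NoZeroDivisors R :=
  haveI := h R ‹_›
  inferInstance

end Literature.AlgebraicGeometry.Resolution

end
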